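import Literature.NumberTheory.Automorphic.ArchOrbitMeasurePartialTestFunction     -- ★ p841031 (R1-a) F0P3a-p07 (g7): `exists_contDiff_eq_integral_insert` (mixed partial test functions against ANY Radon measures)
import Literature.NumberTheory.Automorphic.ArchEndoscopicDiagonalCongruence        -- ★ p841011 (R3-a): (R1G) `exists_tendsto_deriv_two_sin_smul_orbitalIntegral` by import + the weights `β₂ = (½, −½)`
import Literature.NumberTheory.Automorphic.ArchTorusOrbitalFubiniProper            -- ★ (V7)-proper: `isCompact_setOf_conj_circleDiagonal_mem_of_injective` (orbit maps at regular torus points are proper)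
import HarnessLib

/-!
# Harish-Chandra's rank-one limit formula for MIXED PARTIAL ORBITAL TEST FUNCTIONS: one place moves to the centre, the other places are integrated against arbitrary
# Radon measures (orbit measures at regular points, Dirac masses at central points) — the H-side one-step of Lemma 14.5.2 (c) at `∞` (Rogawski 1990 p. 238, §8.4; Varadarajan §6.4)

Topic `NumberTheory/Automorphic`; namespace `Literature.NumberTheory.Automorphic.UnitaryGroup`.  THEOREMS ONLY (no `def`, no instance, no notation, no axiom, no named fact, no `sorry`).
Cell `pub/hodgecm-mathlib`, ENGINE T1 (crux H413 = `stmt-HodgeConjecture-24833`); ROAD-Sd residual R3 «(S-c) central vanishing» = `stub_ScCore` of the registered pay-down line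
`Cruxes/H413/Lines/F0_P3a_SdArch.lean`; brick (R3-c) step 1 of the census `CENSUS-R3-ScCentralVanishing.F0P3a-p02g10.md` (mechanism (M1) «HC at the centre of `H_∞`, one place at a
time»); LEAD F0P3a-plan (g9) WORDS T8-53 ∕ T8-61 (C1) («p02 CONSUMES ★ (R1-a) for (R3-c)»); author F0P3a-p02 (g10), 2026-09-01.

WHY.  (S-c) says the `Δ′_∞`-transfer `aH` of a smooth `a′` on the inner form vanishes at the rational central elements of `H_∞ = U(Φ₂)_∞ × U(Φ₁)_∞`.  Print [p. 238]: at a compact place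
`D_G Φ(γ′, a′) → 0` and «the limit formula for `H` implies `aH(γ₀) = 0`».  In the tree `aH` is a GLOBAL archimedean test function (not `⊗_w aH_w`), so the limit formula must be run ONE
PLACE AT A TIME on `∏_w U(½,−½)_w` (after ★ (R3-a)'s diagonalisation and the abelian factor dropped, ★ `OrbitalMeasureOfProdCommFactor`): at the moving place `w₀` the torus point
`diag(z e^{iψ}, z e^{−iψ})` tends to the centre `z•1`; at every other place `w′` the conjugacy variable has ALREADY been integrated out — against the ORBIT MEASURE of a regular torus
point (places not yet taken to the centre) or against the DIRAC MASS at `z_{w′}•1` (places already there).  ★ (R1-a) (p07) says that for ANY Radon measures `μ_{w′}` the resulting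
partial function on `G_{w₀}` is a per-place test function; ★ (R1G) (B-p17∕p07∕p05∕p06) is Harish-Chandra's limit formula on `G_{w₀} = U(σ_{w₀} diag α)`, `e₀e₁ < 0`.  This file composes them:
the constant `C ≠ 0` depends on `(L, α, w₀, μ₀)` only — NOT on the other-place measures — which is what makes the descent over places (census (M1), induction `IH(S) ⇒ IH(S ∖ w₁)`) run
with ONE constant per place.

WHAT IS PROVED.
§1 **`exists_tendsto_deriv_two_sin_smul_integral_integral_insert`** — for `α : Fin 2 → L` (`α_i ≠ 0`), a complex place `w₀` with `σ_{w₀}α` real of opposite signs, a Haar measure `μ₀` on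
   `G_{w₀} = archLocal L 2 (diag α) w₀`: `∃ C ≠ 0, ∀` Radon `μ_{w′}` (`w′ ≠ w₀`), `∀ Θ : M₂(L ⊗ ℝ) → E` smooth with `g ↦ Θ ↑↑g` compactly supported on `G_∞ = U(diag α)(L⁺ ⊗ ℝ)`, `∀ z : S¹`,
   `lim_{ψ→0, ψ≠0} ∂_ψ [2 sin ψ · ∫_{G_{w₀}} ∫ Θ ↑↑e⁻¹(k·diag(z e^{iψ}, z e^{−iψ})·k⁻¹, o) d(⊗μ_{w′})(o) dμ₀(k)] = C • ∫ Θ ↑↑e⁻¹(z•1, o) d(⊗μ_{w′})(o)`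
   and differentiability on `0 < |ψ| < 1` (★ (R1-a) letter form + ★ cutoff + ★ (R1G)); `e⁻¹(x′, o)` is ★ (V7)'s assembled family, token-identical with ★ (R1-a).
§2 `…_quasiSplitTwo` — the same at EVERY complex place for the endoscopic 2-block weights `β₂ = (½, −½)` (★ (R3-a) §1: real, opposite signs everywhere).
§3 the calculus of the descent (generic, `E`-valued): `tendsto_neg_nhdsWithin_ne_zero`, **`tendsto_deriv_finset_sum_sub_comp_neg`** (`∂_ψ Σ_j [g_j(ψ) − g_j(−ψ)] → 2 • Σ_j V_j` when
   `∂g_j → V_j` on `𝓝[≠] 0`: the stable pair `{diag(a,b), diag(b,a)}` at the moving place is `ψ ↦ −ψ`), `deriv_congr_of_eventuallyEq_nhdsWithin_ne`, **`smul_eq_zero_of_tendsto_deriv_of_eventuallyEq`**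
   (if the symmetrised sum agrees near `0` with a function whose derivative tends to `0` — the `G′`-side at a compact place, census (M2)(M3) — then `Σ_j V_j = 0`: one descent step).
§4 the admissible other-place measures: **`isFiniteMeasureOnCompacts_map_conj_circleDiagonal`** (the orbit measure `(ν).map (g ↦ g·diag(u)·g⁻¹)` of a REGULAR torus point is Radon —
   ★ (V7)-proper), `sigmaFinite_map_conj_circleDiagonal`, `integral_map_conj_circleDiagonal` (`∫ F d(conj_* ν) = ∫ F(g·diag(u)·g⁻¹) dν(g)` for continuous `F`); Dirac masses are Radon by instance.
HONEST LABEL: HC_CM is proved only modulo the 7 printed citations until rung 0 closes; this file is real analysis over ★ (R1G)∕(R1-a) and pays nothing by itself.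

## References
* [Varadarajan1989] V. S. Varadarajan, *An Introduction to Harmonic Analysis on Semisimple Lie Groups* (1989), §6.4 Thm. 22 (limit formula).
* [Rogawski1990] J. D. Rogawski, *Automorphic Representations of Unitary Groups in Three Variables*, Ann. of Math. Stud. 123 (1990), §14.5 Lemma 14.5.2 (c) p. 238; §8.4 pp. 126–127; §8.3 p. 122.
* [HormanderALPDO1] L. Hörmander, *The Analysis of Linear Partial Differential Operators I*, 2nd ed. (1990), Thm. 1.1.9, Thm. 1.4.1.
* [BorelJacquet1979] A. Borel, H. Jacquet, *Automorphic forms and automorphic representations*, PSPM 33.1 (1979), §4.1.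
-/

set_option autoImplicit false

noncomputable section

open MeasureTheory Matrix NumberField NumberField.InfinitePlace NumberField.mixedEmbedding Set Function Filter Topology
open scoped MatrixGroups ContDiff

-- the scoped `L^∞`-operator norm on `M_N(ℂ)` and `M_N(L ⊗ ℝ)`, the cell's ambient-smooth convention (★ `ArchimedeanCalculus`, ★ (V7)-smooth, ★ (R1-a))
open scoped Matrix.Norms.Operator

namespace Literature.NumberTheory.Automorphic.UnitaryGroup

/-! ## §1 The one-place limit formula for mixed partial orbital test functions -/

section Insert

variable (L : Type) [Field L] [NumberField L] [IsCMField L] (α : Fin 2 → L)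
  [∀ w : {w : InfinitePlace L // IsComplex w}, MeasurableSpace (archLocal L 2 (Matrix.diagonal α) w)]
  [∀ w : {w : InfinitePlace L // IsComplex w}, BorelSpace (archLocal L 2 (Matrix.diagonal α) w)]
  [∀ w : {w : InfinitePlace L // IsComplex w}, SecondCountableTopology (archLocal L 2 (Matrix.diagonal α) w)]

open scoped Classical in
/-- **HARISH-CHANDRA'S RANK-ONE LIMIT FORMULA FOR MIXED PARTIAL ORBITAL TEST FUNCTIONS** (★ (R1G) ∘ ★ (R1-a)).  For `α : Fin 2 → L` with `α_i ≠ 0`, a complex place `w₀` at which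
`σ_{w₀}α` is real with `e₀e₁ < 0` (`G_{w₀} ≅ U(1,1)`), and a Haar measure `μ₀` on `G_{w₀}`, there is `C ≠ 0` such that for ALL measures `μ_{w′}` (`w′ ≠ w₀`) finite on compacts and
σ-finite, all `Θ : M₂(L ⊗ ℝ) → E` smooth with `g ↦ Θ ↑↑g` compactly supported on `G_∞`, and all `z ∈ S¹`:
`∂_ψ [2 sin ψ · ∫_{G_{w₀}} ∫ Θ ↑↑e⁻¹(k·diag(z e^{iψ}, z e^{−iψ})·k⁻¹, o) d(⊗μ_{w′})(o) dμ₀(k)] → C • ∫ Θ ↑↑e⁻¹(diag(z, z), o) d(⊗μ_{w′})(o)` as `ψ → 0`, `ψ ≠ 0`,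
the function being differentiable at every `0 < |ψ| < 1`.  (`C` is ★ (R1G)'s constant of `(σ_{w₀}, α, μ₀)`: independent of `μ_{w′}`, `Θ`, `z`.)
[cite: Varadarajan1989, §6.4 Thm. 22] [cite: Rogawski1990, §14.5 p. 238; §8.4 pp. 126–127] [cite: HormanderALPDO1, Thm. 1.1.9, Thm. 1.4.1] -/
theorem exists_tendsto_deriv_two_sin_smul_integral_integral_insert {E : Type*} [NormedAddCommGroup E] [NormedSpace ℝ E] [CompleteSpace E]
    (hα : ∀ i, α i ≠ 0) (w₀ : {w : InfinitePlace L // IsComplex w})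
    (hreal : ∀ i, (w₀.1.embedding (α i)).im = 0) (hsgn : (w₀.1.embedding (α 0)).re * (w₀.1.embedding (α 1)).re < 0)
    (μ₀ : Measure (archLocal L 2 (Matrix.diagonal α) w₀)) [hμ₀ : μ₀.IsHaarMeasure] :
    ∃ C : ℝ, C ≠ 0 ∧
      ∀ (μ : ∀ w' : {w : {w : InfinitePlace L // IsComplex w} // ¬ w = w₀}, Measure (archLocal L 2 (Matrix.diagonal α) w'.1))
        [∀ w', IsFiniteMeasureOnCompacts (μ w')] [∀ w', SigmaFinite (μ w')]
        (Θ : Matrix (Fin 2) (Fin 2) (mixedSpace L) → E), ContDiff ℝ (⊤ : ℕ∞) Θ →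
        HasCompactSupport (fun g : arch (↥(maximalRealSubfield L)) L (IsCMField.complexConj L) 2 (Matrix.diagonal α) =>
          Θ ((g : GL (Fin 2) (mixedSpace L)) : Matrix (Fin 2) (Fin 2) (mixedSpace L))) →
        ∀ z : Circle,
          Tendsto (fun ψ : ℝ => deriv (fun ψ : ℝ => (2 * Real.sin ψ) •
              ∫ k : archLocal L 2 (Matrix.diagonal α) w₀,
                ∫ o : (∀ w' : {w : {w : InfinitePlace L // IsComplex w} // ¬ w = w₀}, archLocal L 2 (Matrix.diagonal α) w'.1),
                  Θ ((((archPiEquivCM 2 L (Matrix.diagonal α)).symm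
                    ((MeasurableEquiv.piEquivPiSubtypeProd (fun w : {w : InfinitePlace L // IsComplex w} => ↥(archLocal L 2 (Matrix.diagonal α) w)) (· = w₀)).symm
                      ((MeasurableEquiv.piUnique fun i : {w : {w : InfinitePlace L // IsComplex w} // w = w₀} => ↥(archLocal L 2 (Matrix.diagonal α) i.1)).symm
                        (k * ⟨circleDiagonal 2 ![z * Circle.exp ψ, z * Circle.exp (-ψ)], circleDiagonal_mem_archLocal_diagonal L 2 α w₀ _⟩ * k⁻¹), o)) :
                      arch (↥(maximalRealSubfield L)) L (IsCMField.complexConj L) 2 (Matrix.diagonal α)) : GL (Fin 2) (mixedSpace L)) : Matrix (Fin 2) (Fin 2) (mixedSpace L))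
                ∂(Measure.pi μ) ∂μ₀) ψ)
            (𝓝[≠] 0)
            (𝓝 (C • ∫ o : (∀ w' : {w : {w : InfinitePlace L // IsComplex w} // ¬ w = w₀}, archLocal L 2 (Matrix.diagonal α) w'.1),
                  Θ ((((archPiEquivCM 2 L (Matrix.diagonal α)).symm
                    ((MeasurableEquiv.piEquivPiSubtypeProd (fun w : {w : InfinitePlace L // IsComplex w} => ↥(archLocal L 2 (Matrix.diagonal α) w)) (· = w₀)).symm
                      ((MeasurableEquiv.piUnique fun i : {w : {w : InfinitePlace L // IsComplex w} // w = w₀} => ↥(archLocal L 2 (Matrix.diagonal α) i.1)).symm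
                        ⟨circleDiagonal 2 ![z, z], circleDiagonal_mem_archLocal_diagonal L 2 α w₀ _⟩, o)) :
                      arch (↥(maximalRealSubfield L)) L (IsCMField.complexConj L) 2 (Matrix.diagonal α)) : GL (Fin 2) (mixedSpace L)) : Matrix (Fin 2) (Fin 2) (mixedSpace L))
                ∂(Measure.pi μ))) ∧
          ∀ ψ ∈ Ioo (-1 : ℝ) 1, ψ ≠ 0 → DifferentiableAt ℝ (fun ψ : ℝ => (2 * Real.sin ψ) •
              ∫ k : archLocal L 2 (Matrix.diagonal α) w₀,
                ∫ o : (∀ w' : {w : {w : InfinitePlace L // IsComplex w} // ¬ w = w₀}, archLocal L 2 (Matrix.diagonal α) w'.1),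
                  Θ ((((archPiEquivCM 2 L (Matrix.diagonal α)).symm
                    ((MeasurableEquiv.piEquivPiSubtypeProd (fun w : {w : InfinitePlace L // IsComplex w} => ↥(archLocal L 2 (Matrix.diagonal α) w)) (· = w₀)).symm
                      ((MeasurableEquiv.piUnique fun i : {w : {w : InfinitePlace L // IsComplex w} // w = w₀} => ↥(archLocal L 2 (Matrix.diagonal α) i.1)).symm
                        (k * ⟨circleDiagonal 2 ![z * Circle.exp ψ, z * Circle.exp (-ψ)], circleDiagonal_mem_archLocal_diagonal L 2 α w₀ _⟩ * k⁻¹), o)) :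
                      arch (↥(maximalRealSubfield L)) L (IsCMField.complexConj L) 2 (Matrix.diagonal α)) : GL (Fin 2) (mixedSpace L)) : Matrix (Fin 2) (Fin 2) (mixedSpace L))
                ∂(Measure.pi μ) ∂μ₀) ψ := by
  -- ★ (R1G) on `G_{w₀} = U(σ_{w₀}, σ_{w₀} diag α)` (= `archLocal L 2 (diag α) w₀` by `rfl`), constant `C` fixed once and for all
  obtain ⟨C, hC, hlim⟩ := @exists_tendsto_deriv_two_sin_smul_orbitalIntegral E _ _ _ L _ (w₀.1.embedding : L →+* ℂ) α hreal hsgn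
    (inferInstance : MeasurableSpace (archLocal L 2 (Matrix.diagonal α) w₀)) (inferInstance : BorelSpace (archLocal L 2 (Matrix.diagonal α) w₀)) μ₀ hμ₀
  refine ⟨C, hC, fun μ _ _ Θ hΘ hΘc z => ?_⟩
  -- ★ (R1-a): the mixed partial integral is a per-place test function `Θ'` on `G_{w₀}` …
  obtain ⟨Θ', hΘ', hΘ'c, hΘ'eq⟩ := exists_contDiff_eq_integral_insert L 2 α hα w₀ μ Θ hΘ hΘc
  -- … and ★ cutoff makes it an AMBIENT test function `Θ''` on `M₂(ℂ)` agreeing with `Θ'` on the group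
  have hι : Continuous fun k : archLocal L 2 (Matrix.diagonal α) w₀ => ((k : GL (Fin 2) ℂ) : Matrix (Fin 2) (Fin 2) ℂ) :=
    Units.continuous_val.comp continuous_subtype_val
  obtain ⟨Θ'', hΘ'', hΘ''c, -, hΘ''eq⟩ := Literature.Analysis.Calculus.exists_contDiff_hasCompactSupport_comp_eq hι hΘ' hΘ'c
  have hΘ''eq' : ∀ x : archLocal L 2 (Matrix.diagonal α) w₀,
      Θ'' ((x : GL (Fin 2) ℂ) : Matrix (Fin 2) (Fin 2) ℂ) = Θ' ((x : GL (Fin 2) ℂ) : Matrix (Fin 2) (Fin 2) ℂ) := fun x => hΘ''eq x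
  -- ★ (R1G) for `Θ''`
  obtain ⟨h1, h2⟩ := hlim Θ'' (hΘ''.of_le (by exact_mod_cast le_top)) hΘ''c z
  -- the central value `z•1 = ↑↑diag(z, z)`
  have hz1 : ((z : ℂ) • (1 : Matrix (Fin 2) (Fin 2) ℂ)) =
      (((⟨circleDiagonal 2 ![z, z], circleDiagonal_mem_archLocal_diagonal L 2 α w₀ _⟩ : archLocal L 2 (Matrix.diagonal α) w₀) : GL (Fin 2) ℂ) :
        Matrix (Fin 2) (Fin 2) ℂ) := by
    rw [Matrix.smul_one_eq_diagonal]
    show _ = ((circleDiagonal 2 ![z, z] : GL (Fin 2) ℂ) : Matrix (Fin 2) (Fin 2) ℂ)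
    rw [coe_circleDiagonal]
    congr 1
    funext i
    fin_cases i <;> rfl
  -- identify ★ (R1G)'s integrand and value with ours
  have eF : (fun ψ : ℝ => (2 * Real.sin ψ) •
      ∫ k : archLocal L 2 (Matrix.diagonal α) w₀,
        ∫ o : (∀ w' : {w : {w : InfinitePlace L // IsComplex w} // ¬ w = w₀}, archLocal L 2 (Matrix.diagonal α) w'.1),
          Θ ((((archPiEquivCM 2 L (Matrix.diagonal α)).symm
            ((MeasurableEquiv.piEquivPiSubtypeProd (fun w : {w : InfinitePlace L // IsComplex w} => ↥(archLocal L 2 (Matrix.diagonal α) w)) (· = w₀)).symm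
              ((MeasurableEquiv.piUnique fun i : {w : {w : InfinitePlace L // IsComplex w} // w = w₀} => ↥(archLocal L 2 (Matrix.diagonal α) i.1)).symm
                (k * ⟨circleDiagonal 2 ![z * Circle.exp ψ, z * Circle.exp (-ψ)], circleDiagonal_mem_archLocal_diagonal L 2 α w₀ _⟩ * k⁻¹), o)) :
              arch (↥(maximalRealSubfield L)) L (IsCMField.complexConj L) 2 (Matrix.diagonal α)) : GL (Fin 2) (mixedSpace L)) : Matrix (Fin 2) (Fin 2) (mixedSpace L))
        ∂(Measure.pi μ) ∂μ₀) =
      fun ψ : ℝ => (2 * Real.sin ψ) •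
        ∫ k : archLocal L 2 (Matrix.diagonal α) w₀,
          Θ'' (((k * ⟨circleDiagonal 2 ![z * Circle.exp ψ, z * Circle.exp (-ψ)], circleDiagonal_mem_archLocal_diagonal L 2 α w₀ _⟩ * k⁻¹ :
            archLocal L 2 (Matrix.diagonal α) w₀) : GL (Fin 2) ℂ) : Matrix (Fin 2) (Fin 2) ℂ) ∂μ₀ := by
    funext ψ
    congr 1
    refine integral_congr_ae (Eventually.of_forall fun k => ?_)
    simp only []
    rw [hΘ''eq', hΘ'eq]
  have eV : (∫ o : (∀ w' : {w : {w : InfinitePlace L // IsComplex w} // ¬ w = w₀}, archLocal L 2 (Matrix.diagonal α) w'.1),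
        Θ ((((archPiEquivCM 2 L (Matrix.diagonal α)).symm
          ((MeasurableEquiv.piEquivPiSubtypeProd (fun w : {w : InfinitePlace L // IsComplex w} => ↥(archLocal L 2 (Matrix.diagonal α) w)) (· = w₀)).symm
            ((MeasurableEquiv.piUnique fun i : {w : {w : InfinitePlace L // IsComplex w} // w = w₀} => ↥(archLocal L 2 (Matrix.diagonal α) i.1)).symm
              ⟨circleDiagonal 2 ![z, z], circleDiagonal_mem_archLocal_diagonal L 2 α w₀ _⟩, o)) :
            arch (↥(maximalRealSubfield L)) L (IsCMField.complexConj L) 2 (Matrix.diagonal α)) : GL (Fin 2) (mixedSpace L)) : Matrix (Fin 2) (Fin 2) (mixedSpace L))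
        ∂(Measure.pi μ)) = Θ'' ((z : ℂ) • (1 : Matrix (Fin 2) (Fin 2) ℂ)) := by
    rw [hz1, hΘ''eq', hΘ'eq]
  refine ⟨?_, fun ψ hψ hψ0 => ?_⟩
  · rw [eF, eV]
    exact h1
  · rw [eF]
    exact h2 ψ hψ hψ0

end Insert

/-! ## §2 The endoscopic 2-block `β₂ = (½, −½)`: the one-step formula at EVERY complex place -/

section QuasiSplitTwo

variable (L : Type) [Field L] [NumberField L] [IsCMField L]
  [∀ w : {w : InfinitePlace L // IsComplex w}, MeasurableSpace (archLocal L 2 (Matrix.diagonal ![(2 : L)⁻¹, -(2 : L)⁻¹]) w)]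
  [∀ w : {w : InfinitePlace L // IsComplex w}, BorelSpace (archLocal L 2 (Matrix.diagonal ![(2 : L)⁻¹, -(2 : L)⁻¹]) w)]
  [∀ w : {w : InfinitePlace L // IsComplex w}, SecondCountableTopology (archLocal L 2 (Matrix.diagonal ![(2 : L)⁻¹, -(2 : L)⁻¹]) w)]

open scoped Classical in
/-- **THE ONE-STEP FORMULA ON THE ENDOSCOPIC 2-BLOCK AT EVERY PLACE**: §1 for `α = β₂ = (½, −½)` (★ (R3-a): `σ_wβ₂` real with `re σ_w(½)·re σ_w(−½) < 0` at every complex `w`,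
so `U(½,−½)_w ≅ U(1,1)` everywhere — the `H`-side of (4.3.1) is NONCOMPACT at every place and Harish-Chandra's limit formula runs at each of them).
[cite: Varadarajan1989, §6.4 Thm. 22] [cite: Rogawski1990, §14.5 p. 238; §4.9 p. 54] -/
theorem exists_tendsto_deriv_two_sin_smul_integral_integral_insert_quasiSplitTwo {E : Type*} [NormedAddCommGroup E] [NormedSpace ℝ E] [CompleteSpace E]
    (w₀ : {w : InfinitePlace L // IsComplex w}) (μ₀ : Measure (archLocal L 2 (Matrix.diagonal ![(2 : L)⁻¹, -(2 : L)⁻¹]) w₀)) [μ₀.IsHaarMeasure] :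
    ∃ C : ℝ, C ≠ 0 ∧
      ∀ (μ : ∀ w' : {w : {w : InfinitePlace L // IsComplex w} // ¬ w = w₀}, Measure (archLocal L 2 (Matrix.diagonal ![(2 : L)⁻¹, -(2 : L)⁻¹]) w'.1))
        [∀ w', IsFiniteMeasureOnCompacts (μ w')] [∀ w', SigmaFinite (μ w')]
        (Θ : Matrix (Fin 2) (Fin 2) (mixedSpace L) → E), ContDiff ℝ (⊤ : ℕ∞) Θ →
        HasCompactSupport (fun g : arch (↥(maximalRealSubfield L)) L (IsCMField.complexConj L) 2 (Matrix.diagonal ![(2 : L)⁻¹, -(2 : L)⁻¹]) =>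
          Θ ((g : GL (Fin 2) (mixedSpace L)) : Matrix (Fin 2) (Fin 2) (mixedSpace L))) →
        ∀ z : Circle,
          Tendsto (fun ψ : ℝ => deriv (fun ψ : ℝ => (2 * Real.sin ψ) •
              ∫ k : archLocal L 2 (Matrix.diagonal ![(2 : L)⁻¹, -(2 : L)⁻¹]) w₀,
                ∫ o : (∀ w' : {w : {w : InfinitePlace L // IsComplex w} // ¬ w = w₀}, archLocal L 2 (Matrix.diagonal ![(2 : L)⁻¹, -(2 : L)⁻¹]) w'.1),
                  Θ ((((archPiEquivCM 2 L (Matrix.diagonal ![(2 : L)⁻¹, -(2 : L)⁻¹])).symm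
                    ((MeasurableEquiv.piEquivPiSubtypeProd (fun w : {w : InfinitePlace L // IsComplex w} => ↥(archLocal L 2 (Matrix.diagonal ![(2 : L)⁻¹, -(2 : L)⁻¹]) w)) (· = w₀)).symm
                      ((MeasurableEquiv.piUnique fun i : {w : {w : InfinitePlace L // IsComplex w} // w = w₀} => ↥(archLocal L 2 (Matrix.diagonal ![(2 : L)⁻¹, -(2 : L)⁻¹]) i.1)).symm
                        (k * ⟨circleDiagonal 2 ![z * Circle.exp ψ, z * Circle.exp (-ψ)], circleDiagonal_mem_archLocal_diagonal L 2 ![(2 : L)⁻¹, -(2 : L)⁻¹] w₀ _⟩ * k⁻¹), o)) :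
                      arch (↥(maximalRealSubfield L)) L (IsCMField.complexConj L) 2 (Matrix.diagonal ![(2 : L)⁻¹, -(2 : L)⁻¹])) : GL (Fin 2) (mixedSpace L)) :
                      Matrix (Fin 2) (Fin 2) (mixedSpace L))
                ∂(Measure.pi μ) ∂μ₀) ψ)
            (𝓝[≠] 0)
            (𝓝 (C • ∫ o : (∀ w' : {w : {w : InfinitePlace L // IsComplex w} // ¬ w = w₀}, archLocal L 2 (Matrix.diagonal ![(2 : L)⁻¹, -(2 : L)⁻¹]) w'.1),
                  Θ ((((archPiEquivCM 2 L (Matrix.diagonal ![(2 : L)⁻¹, -(2 : L)⁻¹])).symm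
                    ((MeasurableEquiv.piEquivPiSubtypeProd (fun w : {w : InfinitePlace L // IsComplex w} => ↥(archLocal L 2 (Matrix.diagonal ![(2 : L)⁻¹, -(2 : L)⁻¹]) w)) (· = w₀)).symm
                      ((MeasurableEquiv.piUnique fun i : {w : {w : InfinitePlace L // IsComplex w} // w = w₀} => ↥(archLocal L 2 (Matrix.diagonal ![(2 : L)⁻¹, -(2 : L)⁻¹]) i.1)).symm
                        ⟨circleDiagonal 2 ![z, z], circleDiagonal_mem_archLocal_diagonal L 2 ![(2 : L)⁻¹, -(2 : L)⁻¹] w₀ _⟩, o)) :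
                      arch (↥(maximalRealSubfield L)) L (IsCMField.complexConj L) 2 (Matrix.diagonal ![(2 : L)⁻¹, -(2 : L)⁻¹])) : GL (Fin 2) (mixedSpace L)) :
                      Matrix (Fin 2) (Fin 2) (mixedSpace L))
                ∂(Measure.pi μ))) ∧
          ∀ ψ ∈ Ioo (-1 : ℝ) 1, ψ ≠ 0 → DifferentiableAt ℝ (fun ψ : ℝ => (2 * Real.sin ψ) •
              ∫ k : archLocal L 2 (Matrix.diagonal ![(2 : L)⁻¹, -(2 : L)⁻¹]) w₀,
                ∫ o : (∀ w' : {w : {w : InfinitePlace L // IsComplex w} // ¬ w = w₀}, archLocal L 2 (Matrix.diagonal ![(2 : L)⁻¹, -(2 : L)⁻¹]) w'.1),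
                  Θ ((((archPiEquivCM 2 L (Matrix.diagonal ![(2 : L)⁻¹, -(2 : L)⁻¹])).symm
                    ((MeasurableEquiv.piEquivPiSubtypeProd (fun w : {w : InfinitePlace L // IsComplex w} => ↥(archLocal L 2 (Matrix.diagonal ![(2 : L)⁻¹, -(2 : L)⁻¹]) w)) (· = w₀)).symm
                      ((MeasurableEquiv.piUnique fun i : {w : {w : InfinitePlace L // IsComplex w} // w = w₀} => ↥(archLocal L 2 (Matrix.diagonal ![(2 : L)⁻¹, -(2 : L)⁻¹]) i.1)).symm
                        (k * ⟨circleDiagonal 2 ![z * Circle.exp ψ, z * Circle.exp (-ψ)], circleDiagonal_mem_archLocal_diagonal L 2 ![(2 : L)⁻¹, -(2 : L)⁻¹] w₀ _⟩ * k⁻¹), o)) :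
                      arch (↥(maximalRealSubfield L)) L (IsCMField.complexConj L) 2 (Matrix.diagonal ![(2 : L)⁻¹, -(2 : L)⁻¹])) : GL (Fin 2) (mixedSpace L)) :
                      Matrix (Fin 2) (Fin 2) (mixedSpace L))
                ∂(Measure.pi μ) ∂μ₀) ψ :=
  exists_tendsto_deriv_two_sin_smul_integral_integral_insert L ![(2 : L)⁻¹, -(2 : L)⁻¹] (quasiSplitWeightsTwo_ne_zero L) w₀
    (im_embedding_quasiSplitWeightsTwo_eq_zero L w₀) (re_embedding_quasiSplitWeightsTwo_mul_neg L w₀) μ₀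

end QuasiSplitTwo

/-! ## §3 The calculus of the descent: symmetrised sums over the stable pair `ψ ↦ −ψ`, and vanishing -/

section Descent

variable {E : Type*} [NormedAddCommGroup E] [NormedSpace ℝ E]

/-- `ψ ↦ −ψ` preserves the punctured neighbourhood filter of `0` (the stable partner `diag(b, a)` of `diag(a, b) = diag(z e^{iψ}, z e^{−iψ})` is the point `−ψ` of the same curve).
[cite: Rogawski1990, §14.5 p. 238; §4.9 p. 54] -/
theorem tendsto_neg_nhdsWithin_ne_zero : Tendsto (fun ψ : ℝ => -ψ) (𝓝[≠] (0 : ℝ)) (𝓝[≠] 0) := by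
  refine tendsto_nhdsWithin_iff.2 ⟨?_, ?_⟩
  · have h : Tendsto (fun ψ : ℝ => -ψ) (𝓝 (0 : ℝ)) (𝓝 0) := by
      simpa only [neg_zero] using (continuous_neg.tendsto (0 : ℝ))
    exact h.mono_left nhdsWithin_le_nhds
  · exact eventually_nhdsWithin_of_forall fun ψ hψ => by
      simp only [mem_compl_iff, mem_singleton_iff, neg_eq_zero] at hψ ⊢
      exact hψ

/-- **DERIVATIVE OF A SYMMETRISED FINITE SUM**: if each `g_j` is differentiable at every `0 < |ψ| < 1` and `∂g_j → V_j` along `𝓝[≠] 0`, then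
`∂_ψ Σ_{j∈s} [g_j(ψ) − g_j(−ψ)] → 2 • Σ_{j∈s} V_j` along `𝓝[≠] 0` (the `H_∞`-stable class of a `G`-regular torus point is `∏_w {diag(a_w,b_w), diag(b_w,a_w)}`; at the moving place the
partner is `ψ ↦ −ψ` and `2 sin ψ · O(−ψ) = −[2 sin(−ψ) · O(−ψ)]`, so the stable sum is `Σ_j [g_j(ψ) − g_j(−ψ)]` over the other-place labels `j`).
[cite: Varadarajan1989, §6.4 Thm. 22] [cite: Rogawski1990, §14.5 p. 238] -/
theorem tendsto_deriv_finset_sum_sub_comp_neg {ι : Type*} (s : Finset ι) (g : ι → ℝ → E) (V : ι → E)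
    (hd : ∀ j ∈ s, ∀ ψ ∈ Ioo (-1 : ℝ) 1, ψ ≠ 0 → DifferentiableAt ℝ (g j) ψ)
    (hlim : ∀ j ∈ s, Tendsto (fun ψ : ℝ => deriv (g j) ψ) (𝓝[≠] 0) (𝓝 (V j))) :
    Tendsto (fun ψ : ℝ => deriv (fun ψ : ℝ => ∑ j ∈ s, (g j ψ - g j (-ψ))) ψ) (𝓝[≠] 0) (𝓝 ((2 : ℝ) • ∑ j ∈ s, V j)) := by
  -- on `0 < |ψ| < 1` the derivative is `Σ_j (g_j′(ψ) + g_j′(−ψ))`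
  have hIoo : ∀ᶠ ψ : ℝ in 𝓝[≠] 0, ψ ∈ Ioo (-1 : ℝ) 1 ∧ ψ ≠ 0 := by
    refine Filter.inter_mem (mem_nhdsWithin_of_mem_nhds (Ioo_mem_nhds (by norm_num) (by norm_num))) self_mem_nhdsWithin
  have hderiv : ∀ᶠ ψ : ℝ in 𝓝[≠] 0,
      deriv (fun ψ : ℝ => ∑ j ∈ s, (g j ψ - g j (-ψ))) ψ = ∑ j ∈ s, (deriv (g j) ψ + deriv (g j) (-ψ)) := by
    filter_upwards [hIoo] with ψ hψ
    have hneg : -ψ ∈ Ioo (-1 : ℝ) 1 := by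
      simp only [mem_Ioo] at hψ ⊢
      constructor <;> linarith [hψ.1.1, hψ.1.2]
    have hψ0' : -ψ ≠ 0 := neg_ne_zero.2 hψ.2
    have hsum : HasDerivAt (fun ψ : ℝ => ∑ j ∈ s, (g j ψ - g j (-ψ))) (∑ j ∈ s, (deriv (g j) ψ + deriv (g j) (-ψ))) ψ := by
      refine HasDerivAt.fun_sum fun j hj => ?_
      have h1 : HasDerivAt (g j) (deriv (g j) ψ) ψ := (hd j hj ψ hψ.1 hψ.2).hasDerivAt
      have h2 : HasDerivAt (fun ψ : ℝ => g j (-ψ)) ((-1 : ℝ) • deriv (g j) (-ψ)) ψ := by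
        have hg : HasDerivAt (g j) (deriv (g j) (-ψ)) (-ψ) := (hd j hj (-ψ) hneg hψ0').hasDerivAt
        exact hg.scomp ψ (hasDerivAt_neg ψ)
      have h3 := h1.sub h2
      simp only [neg_smul, one_smul, sub_neg_eq_add] at h3
      exact h3
    exact hsum.deriv
  refine (Filter.tendsto_congr' hderiv).2 ?_
  have h2 : ((2 : ℝ) • ∑ j ∈ s, V j) = ∑ j ∈ s, (V j + V j) := by
    rw [two_smul, ← Finset.sum_add_distrib]
  rw [h2]
  refine tendsto_finsetSum s fun j hj => ?_
  exact (hlim j hj).add ((hlim j hj).comp tendsto_neg_nhdsWithin_ne_zero)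

/-- Functions that agree on a punctured neighbourhood of `0` have the same derivative along `𝓝[≠] 0`. [cite: Varadarajan1989, §6.4 Thm. 22] -/
theorem deriv_congr_of_eventuallyEq_nhdsWithin_ne {F r : ℝ → E} (hFr : F =ᶠ[𝓝[≠] (0 : ℝ)] r) :
    (fun ψ : ℝ => deriv F ψ) =ᶠ[𝓝[≠] (0 : ℝ)] fun ψ : ℝ => deriv r ψ := by
  -- `{ψ ≠ 0 | F ψ = r ψ}` contains `U ∖ {0}` for an open `U ∋ 0`; at `ψ ∈ U ∖ {0}` the two functions agree on the open neighbourhood `U ∖ {0}` of `ψ`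
  obtain ⟨U, hU, hU0, hsub⟩ := mem_nhdsWithin.1 hFr
  have hmem : {(0 : ℝ)}ᶜ ∩ U ∈ 𝓝[≠] (0 : ℝ) := inter_mem_nhdsWithin _ (hU.mem_nhds hU0)
  filter_upwards [hmem] with ψ hψ
  refine Filter.EventuallyEq.deriv_eq ?_
  have hopen : IsOpen ({(0 : ℝ)}ᶜ ∩ U) := isOpen_compl_singleton.inter hU
  filter_upwards [hopen.mem_nhds hψ] with y hy
  exact hsub ⟨hy.2, hy.1⟩

/-- **ONE DESCENT STEP (vanishing)**: if `∂F → C • V` along `𝓝[≠] 0` with `C ≠ 0`, and `F` agrees near `0` (`ψ ≠ 0`) with a function `r` whose derivative tends to `0` there, then `V = 0`.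
In (S-c): `F(ψ) = 2 sin ψ · Φ^{st}_{H_∞}(γ_H(ψ), aH)` (limit `C • [stable orbital integral with the moving place AT the centre]` by §1 + `tendsto_deriv_finset_sum_sub_comp_neg`), `r` = the
`G′`-side of (4.3.1) along the same curve, flat at a compact place [p. 238: `D_G Φ(γ′, f′) → 0`]. [cite: Rogawski1990, §14.5 Lemma 14.5.2 (c) p. 238] [cite: Varadarajan1989, §6.4 Thm. 22] -/
theorem smul_eq_zero_of_tendsto_deriv_of_eventuallyEq {F r : ℝ → E} {C : ℝ} (hC : C ≠ 0) {V : E}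
    (hF : Tendsto (fun ψ : ℝ => deriv F ψ) (𝓝[≠] 0) (𝓝 (C • V)))
    (hr : Tendsto (fun ψ : ℝ => deriv r ψ) (𝓝[≠] 0) (𝓝 0)) (hFr : F =ᶠ[𝓝[≠] (0 : ℝ)] r) : V = 0 := by
  have h1 : Tendsto (fun ψ : ℝ => deriv F ψ) (𝓝[≠] 0) (𝓝 0) :=
    (Filter.tendsto_congr' (deriv_congr_of_eventuallyEq_nhdsWithin_ne hFr)).2 hr
  have h2 : C • V = 0 := tendsto_nhds_unique hF h1
  rcases smul_eq_zero.1 h2 with h | h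
  · exact absurd h hC
  · exact h

/-- The same with the conclusion on a finite sum (`V = Σ_j V_j`, the shape produced by `tendsto_deriv_finset_sum_sub_comp_neg`): the stable orbital integral one place further in vanishes.
[cite: Rogawski1990, §14.5 Lemma 14.5.2 (c) p. 238] [cite: Varadarajan1989, §6.4 Thm. 22] -/
theorem finset_sum_eq_zero_of_tendsto_deriv_sub_comp_neg {ι : Type*} (s : Finset ι) (g : ι → ℝ → E) (V : ι → E) {C : ℝ} (hC : C ≠ 0)
    (hd : ∀ j ∈ s, ∀ ψ ∈ Ioo (-1 : ℝ) 1, ψ ≠ 0 → DifferentiableAt ℝ (g j) ψ)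
    (hlim : ∀ j ∈ s, Tendsto (fun ψ : ℝ => deriv (g j) ψ) (𝓝[≠] 0) (𝓝 (C • V j)))
    (r : ℝ → E) (hr : Tendsto (fun ψ : ℝ => deriv r ψ) (𝓝[≠] 0) (𝓝 0))
    (hFr : (fun ψ : ℝ => ∑ j ∈ s, (g j ψ - g j (-ψ))) =ᶠ[𝓝[≠] (0 : ℝ)] r) :
    ∑ j ∈ s, V j = 0 := by
  have h := tendsto_deriv_finset_sum_sub_comp_neg s g (fun j => C • V j) hd hlim
  rw [← Finset.smul_sum] at h
  have hC2 : (2 : ℝ) * C ≠ 0 := mul_ne_zero two_ne_zero hC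
  refine smul_eq_zero_of_tendsto_deriv_of_eventuallyEq hC2 (V := ∑ j ∈ s, V j) ?_ hr hFr
  rw [mul_smul]
  exact h

end Descent

/-! ## §4 The admissible other-place measures: orbit measures at regular torus points are Radon -/

section OrbitMeasure

variable (L : Type) [Field L] (N : ℕ) (α : Fin N → L)
  [∀ w : {w : InfinitePlace L // IsComplex w}, MeasurableSpace (archLocal L N (Matrix.diagonal α) w)]
  [∀ w : {w : InfinitePlace L // IsComplex w}, BorelSpace (archLocal L N (Matrix.diagonal α) w)]

/-- The conjugation orbit map of a torus point is continuous, hence measurable. [cite: Rogawski1990, §8.3 p. 122] -/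
theorem measurable_conj_circleDiagonal (w : {w : InfinitePlace L // IsComplex w}) (u : Fin N → Circle) :
    Measurable fun g : archLocal L N (Matrix.diagonal α) w =>
      g * ⟨circleDiagonal N u, circleDiagonal_mem_archLocal_diagonal L N α w u⟩ * g⁻¹ :=
  ((continuous_id.mul continuous_const).mul continuous_id.inv).measurable

/-- **ORBIT MEASURES AT REGULAR TORUS POINTS ARE RADON**: for `u` with distinct entries (a regular point of the diagonal torus of `G_w = U(σ_w diag α)`) and `ν` finite on compact sets,
the orbit measure `conj(diag u)_* ν` is finite on compact sets (the orbit map is proper: ★ `isCompact_setOf_conj_circleDiagonal_mem_of_injective`).  These are the other-place measures of §1 at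
the places not yet taken to the centre. [cite: Rogawski1990, §8.3 p. 122] [cite: BorelJacquet1979, §4.1] -/
theorem isFiniteMeasureOnCompacts_map_conj_circleDiagonal (w : {w : InfinitePlace L // IsComplex w}) (hα : ∀ i, α i ≠ 0)
    (u : Fin N → Circle) (hu : Function.Injective u) (ν : Measure (archLocal L N (Matrix.diagonal α) w)) [IsFiniteMeasureOnCompacts ν] :
    IsFiniteMeasureOnCompacts (ν.map fun g : archLocal L N (Matrix.diagonal α) w =>
      g * ⟨circleDiagonal N u, circleDiagonal_mem_archLocal_diagonal L N α w u⟩ * g⁻¹) := by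
  refine ⟨fun K hK => ?_⟩
  rw [Measure.map_apply (measurable_conj_circleDiagonal L N α w u) hK.measurableSet]
  exact (isCompact_setOf_conj_circleDiagonal_mem_of_injective L N α w hα u hu K hK).measure_lt_top

/-- … and σ-finite (second-countable locally compact group). [cite: Rogawski1990, §8.3 p. 122] -/
theorem sigmaFinite_map_conj_circleDiagonal (w : {w : InfinitePlace L // IsComplex w}) (hα : ∀ i, α i ≠ 0)
    [SecondCountableTopology (archLocal L N (Matrix.diagonal α) w)] [LocallyCompactSpace (archLocal L N (Matrix.diagonal α) w)]
    (u : Fin N → Circle) (hu : Function.Injective u) (ν : Measure (archLocal L N (Matrix.diagonal α) w)) [IsFiniteMeasureOnCompacts ν] :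
    SigmaFinite (ν.map fun g : archLocal L N (Matrix.diagonal α) w =>
      g * ⟨circleDiagonal N u, circleDiagonal_mem_archLocal_diagonal L N α w u⟩ * g⁻¹) := by
  haveI := isFiniteMeasureOnCompacts_map_conj_circleDiagonal L N α w hα u hu ν
  infer_instance

/-- **Integration against an orbit measure is the orbital integral**: `∫ F d(conj(diag u)_* ν) = ∫ F(g·diag(u)·g⁻¹) dν(g)` for continuous `F` (no integrability needed).
[cite: Rogawski1990, §8.3 p. 122] [cite: BorelJacquet1979, §4.1] -/
theorem integral_map_conj_circleDiagonal {E : Type*} [NormedAddCommGroup E] [NormedSpace ℝ E] (w : {w : InfinitePlace L // IsComplex w})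
    [SecondCountableTopology (archLocal L N (Matrix.diagonal α) w)]
    (u : Fin N → Circle) (ν : Measure (archLocal L N (Matrix.diagonal α) w)) (F : archLocal L N (Matrix.diagonal α) w → E) (hF : Continuous F) :
    ∫ x, F x ∂(ν.map fun g : archLocal L N (Matrix.diagonal α) w => g * ⟨circleDiagonal N u, circleDiagonal_mem_archLocal_diagonal L N α w u⟩ * g⁻¹) =
      ∫ g, F (g * ⟨circleDiagonal N u, circleDiagonal_mem_archLocal_diagonal L N α w u⟩ * g⁻¹) ∂ν :=
  integral_map (measurable_conj_circleDiagonal L N α w u).aemeasurable hF.aestronglyMeasurable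

end OrbitMeasure

end Literature.NumberTheory.Automorphic.UnitaryGroup

end
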